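import Summits.AnomalousDissipation.AnomalousDissipation.Theses.MomentParity

/-!
# Line `planar-corner` — crux `MomentParity.MomentLadder` (stmt-AnomalousDissipation-11463)
# ALTERNATIVE line registered by the crux strategist (cstrat s1, 2026-08-17); it does NOT replace `Lines/Sketch.lean`.

Idea (card `planar-mixer-scalar-corner`, r1 triage pass 2/2, never planned): climb the ladder INSIDE the
x₃-invariant ("2½-D") invariant subspace of the order-`N` Galerkin system. There the κ-clause of the crux —
N-uniform resolution of the mean enstrophy of bounded Galerkin-stationary laws at FIXED viscosity, i.e. the
content of `ResolvedDissipation` (14284) / clause (ii) of the live line's stuck stub `stub_oneTrajectoryResolved`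
(= the 3-D mean energy EQUALITY of Galerkin-limit stationary statistical solutions, FMRT IV (1.31), open) — is a
THEOREM (`stub_planarClassResolution`: budget route, stationarity of ‖∇v‖⁴, ‖∇w‖², ‖w‖² + the 2-D cancellation
b(v,v,Av) = 0 + Ladyzhenskaya on T²; no attractor theory), and what remains is loudness of bounded planar-carried
Galerkin-stationary ensembles along ν_j → 0 (`stub_planarGalerkinInvariantLoud` = the sibling crux
`GalerkinInvariantLoud` (14283) with an x₃-invariant force and x₃-invariant carriers: the 2½-D Galerkin-ensemble
zeroth law, all of whose loudness is scalar input ⟨(h, w)⟩ by `PlanarCubicQuiet`). Composition = the logic of the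
landed `ladderGlue_proof` with the two planar clauses threaded.

Stubs (the ONLY sorries):
* `stub_planarClassResolution` — PROVABLE NOW (L): `ResolvedDissipation` restricted to x₃-invariant forces and
  x₃-invariant level-`N` carriers (text = ideator-1's `PlanarClassResolution`, elaborated 2026-08-16).
* `stub_planarGalerkinInvariantLoud` — OPEN (XL): `GalerkinInvariantLoud` with the force clause
  `∀ k, k 2 ≠ 0 → f̂(k) = 0` and the carrier clause `∀ᵐ u, ∀ k, k 2 ≠ 0 → û(k) = 0` inserted.
Composition (kernel-checked, no sorry of its own): `momentLadder_of_stubs : MomentLadder` uses the two stubs BY NAME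
(the `ladderGlue_proof` logic with the planar clauses threaded); `galerkinInvariantLoud_of_stubs` records stub 2 ⇒ 14283.
-/

set_option linter.dupNamespace false

noncomputable section

namespace Summit.AnomalousDissipation.AnomalousDissipation.Cruxes.MomentLadder.PlanarCorner

open MeasureTheory Filter
open scoped BigOperators ENNReal
open Summit.AnomalousDissipation.AnomalousDissipation.Theses.MomentParity

/-! ## Registered stubs -/

/-- STUB 1 (provable, L): `ResolvedDissipation` in the x₃-invariant class — for an x₃-invariant smooth
divergence-free mean-zero force `f`, every `ν > 0` and radius `R` there is ONE schedule `κ` such that every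
level-`N` probability law carried by x₃-invariant fields, supported in `‖u‖ ≤ R` and stationary for Galerkin NS
at `(ν, f)` against all polynomial cylindrical band-limited observables, has `κ`-resolved mean enstrophy,
uniformly in `N`. Plan: stationarity of `‖∇v‖⁴` with `b(v,v,Av) = 0` on T² gives `⟨‖∇v‖⁴⟩ ≤ (‖∇g‖/4π²ν)⁴`;
stationarity of `‖w‖²`, `‖∇w‖²` with `|∫(v·∇w)Δw| ≤ C‖∇v‖‖∇w‖‖Δw‖` (Ladyzhenskaya) and `‖∇w‖² ≤ ‖w‖‖Δw‖`
gives `⟨‖Δw‖²⟩ ≤ G(ν, f, R)`; `ν⟨‖Av‖²⟩ ≤ ‖∇g‖⟨‖∇v‖⟩`; tail `≤ ⟨‖Δu‖²⟩/(4π²κ²)`. -/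
theorem stub_planarClassResolution :
    ∀ f : UnitAddTorus (Fin 3) → EuclideanSpace ℝ (Fin 3), Literature.Analysis.FunctionSpaces.Torus.IsSmooth f → Literature.Analysis.FunctionSpaces.Torus.IsDivFree f → Literature.Analysis.FunctionSpaces.Torus.HasZeroMean f → (∀ k : Fin 3 → ℤ, k 2 ≠ 0 → UnitAddTorus.mFourierCoeff (Literature.Analysis.FunctionSpaces.EuclideanSpace.complexify ∘ f) k = 0) → ∀ ν : ℝ, 0 < ν → ∀ R : ℝ, ∃ κ : ℕ → ℕ, ∀ (N : ℕ) (μ : MeasureTheory.Measure (Literature.Analysis.FunctionSpaces.Torus.energySpace (Fin 3))), MeasureTheory.IsProbabilityMeasure μ → (∀ᵐ (u : Literature.Analysis.FunctionSpaces.Torus.energySpace (Fin 3)) ∂μ, (∀ k ∉ (Literature.Analysis.FunctionSpaces.Torus.freqBall N).erase (0 : Fin 3 → ℤ), UnitAddTorus.mFourierCoeff (Literature.Analysis.FunctionSpaces.EuclideanSpace.complexify ∘ (u.1 : UnitAddTorus (Fin 3) → EuclideanSpace ℝ (Fin 3))) k = 0)) → (∀ᵐ (u : Literature.Analysis.FunctionSpaces.Torus.energySpace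 (Fin 3)) ∂μ, (∀ k : Fin 3 → ℤ, k 2 ≠ 0 → UnitAddTorus.mFourierCoeff (Literature.Analysis.FunctionSpaces.EuclideanSpace.complexify ∘ (u.1 : UnitAddTorus (Fin 3) → EuclideanSpace ℝ (Fin 3))) k = 0)) → (∀ᵐ u ∂μ, ‖u‖ ≤ R) → (∀ (m : ℕ) (g : Fin m → UnitAddTorus (Fin 3) → EuclideanSpace ℝ (Fin 3)) (P : MvPolynomial (Fin m) ℝ), (∀ i, (Literature.Analysis.FunctionSpaces.Torus.IsSmooth (g i) ∧ Literature.Analysis.FunctionSpaces.Torus.IsDivFree (g i) ∧ Literature.Analysis.FunctionSpaces.Torus.HasZeroMean (g i) ∧ (∀ k ∉ (Literature.Analysis.FunctionSpaces.Torus.freqBall N).erase (0 : Fin 3 → ℤ), UnitAddTorus.mFourierCoeff (Literature.Analysis.FunctionSpaces.EuclideanSpace.complexify ∘ (g i)) k = 0))) → MeasureTheory.Integrable (fun u => Literature.Analysis.FluidPDE.Torus.nsGeneratorPairing ν f u (fun x => ∑ i : Fin m, (MvPolynomial.eval (fun j => Literature.Analysis.FluidPDE.Torus.pairing u.1 (g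 j)) (MvPolynomial.pderiv i P)) • g i x)) μ ∧ ∫ u, Literature.Analysis.FluidPDE.Torus.nsGeneratorPairing ν f u (fun x => ∑ i : Fin m, (MvPolynomial.eval (fun j => Literature.Analysis.FluidPDE.Torus.pairing u.1 (g j)) (MvPolynomial.pderiv i P)) • g i x) ∂μ = 0) → ∀ n : ℕ, ∫⁻ (u : Literature.Analysis.FunctionSpaces.Torus.energySpace (Fin 3)), Literature.Analysis.FunctionSpaces.Torus.eGradNormSq (u.1 : UnitAddTorus (Fin 3) → EuclideanSpace ℝ (Fin 3)) ∂μ ≤ (∫⁻ (u : Literature.Analysis.FunctionSpaces.Torus.energySpace (Fin 3)), Literature.Analysis.FunctionSpaces.Torus.eGradNormSq (Literature.Analysis.FunctionSpaces.Torus.fourierTruncate (κ n) (u.1 : UnitAddTorus (Fin 3) → EuclideanSpace ℝ (Fin 3))) ∂μ) + ((n : ENNReal) + 1)⁻¹ := by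
  sorry

/-- STUB 2 (OPEN, XL — the whole remaining difficulty, named): the 2½-D Galerkin-ensemble zeroth law —
`GalerkinInvariantLoud` (stmt-14283) with an x₃-invariant force and x₃-invariant level-`N` carriers: SOME steady
smooth x₃-invariant `f = (g₁, g₂, h)(x₁, x₂)`, `ν_j → 0`, budgets `E, ε > 0`; at every `j` a radius `R`; for
infinitely many `N` a level-`N`, x₃-invariant-carried probability law supported in `‖u‖ ≤ R`, stationary for
Galerkin NS at `(ν_j, f)` against every polynomial cylindrical band-limited observable, with `∫‖u‖² ≤ E` and
`ν_j ∫‖∇u‖² ≥ ε`. By `PlanarCubicQuiet` (proved) the planar part dissipates `O(√ν_j)`, so for large `j` the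
loudness is scalar input `⟨(h, w)⟩ ≥ ε/2` at bounded variance: anomalous dissipation of a steadily sourced
passive scalar stirred by steadily forced bounded-energy 2-D Galerkin ensembles (companion of TwoAndHalfD's
`ScalarAnomalySteadySourceFormal`, stmt-0448, in Galerkin-ensemble currency). Implies `GalerkinInvariantLoud`. -/
theorem stub_planarGalerkinInvariantLoud :
    ∃ f : UnitAddTorus (Fin 3) → EuclideanSpace ℝ (Fin 3), Literature.Analysis.FunctionSpaces.Torus.IsSmooth f ∧ Literature.Analysis.FunctionSpaces.Torus.IsDivFree f ∧ Literature.Analysis.FunctionSpaces.Torus.HasZeroMean f ∧ (∀ k : Fin 3 → ℤ, k 2 ≠ 0 → UnitAddTorus.mFourierCoeff (Literature.Analysis.FunctionSpaces.EuclideanSpace.complexify ∘ f) k = 0) ∧ ∃ (ν : ℕ → ℝ) (E ε : ℝ), (∀ j, 0 < ν j) ∧ Filter.Tendsto ν Filter.atTop (nhds 0) ∧ 0 < ε ∧ ∀ j : ℕ, ∃ R : ℝ, ∃ᶠ N in Filter.atTop, ∃ μ : MeasureTheory.Measure (Literature.Analysis.FunctionSpaces.Torus.energySpace (Fin 3)),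 MeasureTheory.IsProbabilityMeasure μ ∧ (∀ᵐ (u : Literature.Analysis.FunctionSpaces.Torus.energySpace (Fin 3)) ∂μ, (∀ k ∉ (Literature.Analysis.FunctionSpaces.Torus.freqBall N).erase (0 : Fin 3 → ℤ), UnitAddTorus.mFourierCoeff (Literature.Analysis.FunctionSpaces.EuclideanSpace.complexify ∘ (u.1 : UnitAddTorus (Fin 3) → EuclideanSpace ℝ (Fin 3))) k = 0)) ∧ (∀ᵐ (u : Literature.Analysis.FunctionSpaces.Torus.energySpace (Fin 3)) ∂μ, (∀ k : Fin 3 → ℤ, k 2 ≠ 0 → UnitAddTorus.mFourierCoeff (Literature.Analysis.FunctionSpaces.EuclideanSpace.complexify ∘ (u.1 : UnitAddTorus (Fin 3) → EuclideanSpace ℝ (Fin 3))) k = 0)) ∧ (∀ᵐ u ∂μ, ‖u‖ ≤ R) ∧ (∀ (m : ℕ) (g : Fin m → UnitAddTorus (Fin 3) → EuclideanSpace ℝ (Fin 3)) (P : MvPolynomial (Fin m) ℝ), (∀ i, (Literature.Analysis.FunctionSpaces.Torus.IsSmooth (g i) ∧ Literature.Analysis.FunctionSpaces.Torus.IsDivFree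 (g i) ∧ Literature.Analysis.FunctionSpaces.Torus.HasZeroMean (g i) ∧ (∀ k ∉ (Literature.Analysis.FunctionSpaces.Torus.freqBall N).erase (0 : Fin 3 → ℤ), UnitAddTorus.mFourierCoeff (Literature.Analysis.FunctionSpaces.EuclideanSpace.complexify ∘ (g i)) k = 0))) → MeasureTheory.Integrable (fun u => Literature.Analysis.FluidPDE.Torus.nsGeneratorPairing (ν j) f u (fun x => ∑ i : Fin m, (MvPolynomial.eval (fun j => Literature.Analysis.FluidPDE.Torus.pairing u.1 (g j)) (MvPolynomial.pderiv i P)) • g i x)) μ ∧ ∫ u, Literature.Analysis.FluidPDE.Torus.nsGeneratorPairing (ν j) f u (fun x => ∑ i : Fin m, (MvPolynomial.eval (fun j => Literature.Analysis.FluidPDE.Torus.pairing u.1 (g j)) (MvPolynomial.pderiv i P)) • g i x) ∂μ = 0) ∧ Literature.Analysis.FluidPDE.Torus.ensembleEnergy μ ≤ E ∧ ε ≤ Literature.Analysis.FluidPDE.Torus.ensembleDissipation (ν j) μ := by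
  sorry

/-! ## Composition (kernel-checked; concludes the crux BY NAME; the FIRST theorem concluding the crux is the skeleton) -/

/-- The skeleton closes the crux modulo its two registered stubs — the logic of `ladderGlue_proof` with the planar
clauses threaded: `(f, ν, E, ε)` and the radius `R` per `j` from stub 2, the schedule `κ` from stub 1 at `(f, ν j, R)`,
and inside `∃ᶠ N` the stationary law serves every order `d` (degree hypothesis dropped) and is `κ`-resolved by stub 1
applied to itself. -/
theorem momentLadder_of_stubs : MomentLadder := by
  unfold MomentLadder
  obtain ⟨f, hfs, hfd, hfz, hfp, ν, E, ε, hν, hν0, hε, hj⟩ := stub_planarGalerkinInvariantLoud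
  refine ⟨f, hfs, hfd, hfz, ν, E, ε, hν, hν0, hε, fun j => ?_⟩
  obtain ⟨R, hfreq⟩ := hj j
  obtain ⟨κ, hκ⟩ := stub_planarClassResolution f hfs hfd hfz hfp (ν j) (hν j) R
  refine ⟨R, κ, hfreq.mono fun N hN d => ?_⟩
  obtain ⟨μ, hμ, hsupp, hplanar, hball, hstat, hE, hD⟩ := hN
  exact ⟨μ, hμ, hsupp, hball, hκ N μ hμ hsupp hplanar hball hstat, fun m g P hg _ => hstat m g P hg, hE, hD⟩

/-- By-name corollary for the sibling crux: the planar Galerkin-ensemble zeroth law (stub 2) implies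
`GalerkinInvariantLoud` (stmt-14283) — drop the two planar clauses. (So stub 2 sits above the route's top crux; a
refutation of 14283 kills this line by contraposition.) -/
theorem galerkinInvariantLoud_of_stubs : GalerkinInvariantLoud := by
  unfold GalerkinInvariantLoud
  obtain ⟨f, hfs, hfd, hfz, -, ν, E, ε, hν, hν0, hε, hj⟩ := stub_planarGalerkinInvariantLoud
  refine ⟨f, hfs, hfd, hfz, ν, E, ε, hν, hν0, hε, fun j => ?_⟩
  obtain ⟨R, hfreq⟩ := hj j
  refine ⟨R, hfreq.mono fun N hN => ?_⟩
  obtain ⟨μ, hμ, hsupp, -, hball, hstat, hE, hD⟩ := hN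
  exact ⟨μ, hμ, hsupp, hball, hstat, hE, hD⟩

end Summit.AnomalousDissipation.AnomalousDissipation.Cruxes.MomentLadder.PlanarCorner

end
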